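import Literature.AlgebraicGeometry.PlaneCurves.HessePencilCharacteristicThreeWebSingular
import Literature.AlgebraicGeometry.PlaneCurves.HessianCovariance
import HarnessLib

/-!
# The third inflection tangent `ax + by + cz = 0` of Weber's normal form `xy(ax + by + cz) + dz³` (Artebani–Dolgachev, proof of Lemma 1)

Topic `Literature/AlgebraicGeometry/PlaneCurves`, namespace `Literature.AlgebraicGeometry.PlaneCurves`.
Lane `lit-hodgefound`, seat `lit-hodgefound-p37`, row g21-#15; companion of `PlaneCubicWeberNormalForm`
(g21-#13: two flexes ⇒ the form (4)) using `HessePencilCharacteristicThreeWebSingular` (g21-#10: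
`web_eval`, `web_eval_pderiv`, valid over any field) and the tree's `linePoly`.  ANY field, ANY
characteristic.  Everything here is PROVED; no definition, no named fact.

Source — M. Artebani, I. Dolgachev, *The Hesse pencil of plane cubic curves*, Enseign. Math. (2) 55
(2009), §2, proof of Lemma 1, eq. (4) [`paper:arxiv-math_0611590` p0004 L55–56], VERBATIM: "the
equation of `E` can be written in the form `F(x, y, z) = xy(ax + by + cz) + dz³ = 0`, where
`ax + by + cz = 0` is a third inflection tangent line."

## What is here

For `F = xy(ax + by + cz) + dz³` and the point `p₃ = (b, −a, 0)` where the line `ℓ : ax + by + cz = 0`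
meets `z = 0`:
* `web_third_point` — `F(p₃) = 0` and `∇F(p₃) = −ab·(a, b, c)`: the tangent at `p₃` is `ℓ` (when
  `ab ≠ 0`; for `ab = 0` the point is singular, cf. g21-#10);
* `web_linePoly_third` — for every direction `v` on `ℓ` (`av₀ + bv₁ + cv₂ = 0`):
  `F(p₃ + tv) = d·v₂³·t³` EXACTLY, so `ℓ` meets `{F = 0}` at `p₃` with multiplicity `3`;
* **`web_third_flex`** (`ab ≠ 0`) — `p₃` is a flex with inflection tangent `ℓ` in the sense of
  `HessianFlexCriterion` (on the curve, regular, `X³ ∣ linePoly F p₃ v` for all tangent directions).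
The three flexes `(0, 1, 0)`, `(1, 0, 0)`, `(b, −a, 0)` of the form (4) lie on the line `z = 0`.

## References
* [ArtebaniDolgachev2009] M. Artebani, I. Dolgachev, *The Hesse pencil of plane cubic curves*,
  Enseign. Math. (2) 55 (2009) 235–273, §2, proof of Lemma 1, eq. (4).
* [Knapp1992] A. W. Knapp, *Elliptic Curves*, Princeton 1992, §II.3, Prop. 2.9 (intersection
  multiplicity along a line).
-/

set_option autoImplicit false

open MvPolynomial Matrix
open Literature.AlgebraicGeometry.HyperbolicPolynomials

namespace Literature.AlgebraicGeometry.PlaneCurves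

universe u

/-- The web cubic `F = xy(ax + by + cz) + dz³` (local notation, no definition). -/
local notation3 "𝐅[" a ", " b ", " c ", " d "]" =>
  (X 0 * X 1 * (C a * X 0 + C b * X 1 + C c * X 2) + C d * X 2 ^ 3 : MvPolynomial (Fin 3) _)

section WeberThirdFlex

variable {K : Type u} [Field K]

/-- **The third point `p₃ = (b, −a, 0)`**: `F(p₃) = 0` and `∇F(p₃) = −ab·(a, b, c)` — the tangent at
`p₃` is `ax + by + cz = 0`. [cite: ArtebaniDolgachev2009, §2, proof of Lemma 1, eq. (4)] -/
theorem web_third_point (a b c d : K) :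
    eval ![b, -a, 0] 𝐅[a, b, c, d] = 0 ∧
      (fun i => eval ![b, -a, 0] (pderiv i 𝐅[a, b, c, d])) = (-(a * b)) • ![a, b, c] := by
  constructor
  · rw [web_eval]; simp; ring
  · rw [web_eval_pderiv]
    funext i; fin_cases i <;> simp <;> ring

/-- **`ℓ : ax + by + cz = 0` meets `F` at `p₃` with multiplicity three**: for a direction `v` on `ℓ`,
`F(p₃ + tv) = (b + tv₀)(−a + tv₁)·t(av₀ + bv₁ + cv₂) + d(tv₂)³ = d·v₂³·t³`.
[cite: ArtebaniDolgachev2009, §2, proof of Lemma 1 ("a third inflection tangent line")]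
[cite: Knapp1992, §II.3, Prop. 2.9] -/
theorem web_linePoly_third (a b c d : K) {v : Fin 3 → K} (hv : a * v 0 + b * v 1 + c * v 2 = 0) :
    linePoly 𝐅[a, b, c, d] ![b, -a, 0] v = Polynomial.C (d * v 2 ^ 3) * Polynomial.X ^ 3 := by
  have hvC : Polynomial.C a * Polynomial.C (v 0) + Polynomial.C b * Polynomial.C (v 1) +
      Polynomial.C c * Polynomial.C (v 2) = (0 : Polynomial K) := by
    rw [← map_mul, ← map_mul, ← map_mul, ← map_add, ← map_add, hv, map_zero]
  simp only [linePoly, map_add, map_mul, map_pow, aeval_X, aeval_C, Polynomial.algebraMap_eq]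
  simp [map_neg]
  linear_combination ((Polynomial.C (v 0) * Polynomial.X + Polynomial.C b) *
    (Polynomial.C (v 1) * Polynomial.X - Polynomial.C a) * Polynomial.X) * hvC

/-- **Artebani–Dolgachev: "where `ax + by + cz = 0` is a third inflection tangent line".**  For
`ab ≠ 0` the point `p₃ = (b, −a, 0)` is a flex of `xy(ax + by + cz) + dz³` with inflection tangent
`ax + by + cz = 0`: it lies on the curve, is regular, and for every second point `v` of the tangent
(`⟨∇F(p₃), v⟩ = 0`) `X³ ∣ F(p₃ + Xv)` — the flex clause of `HessianFlexCriterion`. [cite: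
ArtebaniDolgachev2009, §2, proof of Lemma 1, eq. (4)] -/
theorem web_third_flex {a b : K} (ha : a ≠ 0) (hb : b ≠ 0) (c d : K) :
    eval ![b, -a, 0] 𝐅[a, b, c, d] = 0 ∧
      (fun i => eval ![b, -a, 0] (pderiv i 𝐅[a, b, c, d])) ≠ 0 ∧
      ∀ v, (fun i => eval ![b, -a, 0] (pderiv i 𝐅[a, b, c, d])) ⬝ᵥ v = 0 →
        Polynomial.X ^ 3 ∣ linePoly 𝐅[a, b, c, d] ![b, -a, 0] v := by
  obtain ⟨h0, hg⟩ := web_third_point a b c d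
  refine ⟨h0, ?_, fun v hv => ?_⟩
  · rw [hg]
    intro h
    have h1 : -(a * b) * a = 0 := by simpa using congrFun h 0
    exact mul_ne_zero (neg_ne_zero.2 (mul_ne_zero ha hb)) ha h1
  · rw [hg, smul_dotProduct, smul_eq_mul, mul_eq_zero] at hv
    have hv' : a * v 0 + b * v 1 + c * v 2 = 0 := by
      rcases hv with h | h
      · exact absurd h (neg_ne_zero.2 (mul_ne_zero ha hb))
      · simpa [dotProduct, Fin.sum_univ_three] using h
    rw [web_linePoly_third a b c d hv']
    exact Dvd.intro_left _ rfl

end WeberThirdFlex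

end Literature.AlgebraicGeometry.PlaneCurves
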